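import Summits.NavierStokesRegularity.NavierStokesRegularity.Theses.CertifiedBlowup

/-!
# Route CertifiedBlowup — support item `CertifiedBlowupEnergyBootstrap` (stmt-NavierStokesRegularity-8643)

The frame-independent half of the certificate layer (Chen–Hou Part I, arXiv:2210.07191, App. A,
Lemma A.2, in energy form): under the finite inequality package
`Literature.NS.BlowupProfileConditions d F` the threshold `E* > 0` of
`Literature.NS.BlowupProfileConditions.energyRHS_neg` (at which the right-hand side of the energy
identity is strictly negative on the sphere `‖v‖ = E*` of `F.unstableᗮ`) traps every trajectory
`v : [0, ∞) → F.X` that stays in `F.unstableᗮ`, whose energy `‖v‖² / 2` has a (right-)derivative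
within `[0, ∞)` bounded by `linForm + Σ nonlinForms + ⟪residual, v⟫`, and which starts with
`‖v 0‖ < E*`: then `‖v τ‖ < E*` for all `τ ≥ 0`.

Proof (continuity / first-exit argument, as filed): the non-strict bound `‖v τ‖² / 2 ≤ E*² / 2` on
every `[0, b]` is Mathlib's fencing theorem `image_le_of_deriv_right_lt_deriv_boundary` with the
constant barrier `B ≡ E*² / 2` (where the energy touches the barrier, `‖v‖ = E*`, so its derivative
is `≤ RHS < 0 = B'`); strictness: equality `‖v τ‖ = E*` at some `τ > 0` would make `τ` an interior
local maximum of the energy, forcing derivative `0` (`IsLocalMax.hasDerivAt_eq_zero`) against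
`< 0`; at `τ = 0` it contradicts the hypothesis.
-/

-- the summit and its single sub-problem share the name (CONVENTIONS §1), as in every Theorems file
set_option linter.dupNamespace false

namespace Summit.NavierStokesRegularity.NavierStokesRegularity.Theorems

open Set Literature.NS
open scoped RealInnerProductSpace

/-- **Route CertifiedBlowup, item `CertifiedBlowupEnergyBootstrap` (stmt-NavierStokesRegularity-8643):
the abstract energy bootstrap of a certified blow-up argument.** Under
`Literature.NS.BlowupProfileConditions d F` there is `E* > 0` such that every `v : ℝ → F.X` with
`v τ ∈ F.unstableᗮ` (`τ ≥ 0`), whose energy `s ↦ ‖v s‖² / 2` has at every `τ ≥ 0` a derivative `e`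
within `[0, ∞)` with `e ≤ F.linForm (v τ) + F.totalNonlin (v τ) + ⟪F.residual, v τ⟫`, and with
`‖v 0‖ < E*`, satisfies `‖v τ‖ < E*` for all `τ ≥ 0`. `E*` is the threshold of
`BlowupProfileConditions.energyRHS_neg`; the trapping is the fencing theorem
`image_le_of_deriv_right_lt_deriv_boundary` plus `IsLocalMax.hasDerivAt_eq_zero` for strictness
(Chen–Hou Part I, Lemma A.2, energy form). [cite: ChenHou2022, App. A, Lemma A.2] -/
theorem certifiedBlowupEnergyBootstrap_proof :
    Summit.NavierStokesRegularity.NavierStokesRegularity.Theses.CertifiedBlowup.CertifiedBlowupEnergyBootstrap := by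
  unfold Summit.NavierStokesRegularity.NavierStokesRegularity.Theses.CertifiedBlowup.CertifiedBlowupEnergyBootstrap
  intro d F hcond
  obtain ⟨Estar, hE, hneg⟩ := hcond.energyRHS_neg
  refine ⟨Estar, hE, fun v horth hderiv h0 => ?_⟩
  choose! e he hle using hderiv
  -- the energy and its continuity on `[0, ∞)`
  set g : ℝ → ℝ := fun s => ‖v s‖ ^ 2 / 2 with hg
  have hcont : ContinuousOn g (Ici 0) := fun τ hτ => (he τ hτ).continuousWithinAt
  -- on the barrier the derivative is strictly negative
  have hsq : ∀ τ : ℝ, g τ = Estar ^ 2 / 2 → ‖v τ‖ = Estar := fun τ hτ =>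
    (pow_left_inj₀ (norm_nonneg _) hE.le two_ne_zero).1 (by simp only [hg] at hτ; linarith)
  have hkey : ∀ τ : ℝ, 0 ≤ τ → ‖v τ‖ = Estar → e τ < 0 := fun τ hτ hnorm =>
    (hle τ hτ).trans_lt (hneg (v τ) (horth τ hτ) hnorm)
  -- non-strict trapping on every `[0, b]` (fencing theorem with constant barrier)
  have hle' : ∀ b : ℝ, ∀ x ∈ Icc 0 b, g x ≤ Estar ^ 2 / 2 := by
    intro b x hx
    refine image_le_of_deriv_right_lt_deriv_boundary (f := g) (f' := e) (a := 0) (b := b)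
      (B := fun _ => Estar ^ 2 / 2) (B' := fun _ => 0) (hcont.mono Icc_subset_Ici_self)
      (fun y hy => (he y hy.1).mono (Ici_subset_Ici.2 hy.1)) ?_
      (fun y => hasDerivAt_const y _) (fun y hy hgy => hkey y hy.1 (hsq y hgy)) hx
    show ‖v 0‖ ^ 2 / 2 ≤ Estar ^ 2 / 2
    nlinarith [norm_nonneg (v 0), h0]
  intro τ hτ
  have hτle : ‖v τ‖ ≤ Estar :=
    (pow_le_pow_iff_left₀ (norm_nonneg _) hE.le two_ne_zero).1
      (by have h := hle' τ τ ⟨hτ, le_rfl⟩; simp only [hg] at h; linarith)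
  rcases hτle.lt_or_eq with hlt | heq
  · exact hlt
  exfalso
  rcases hτ.lt_or_eq with hpos | hzero
  · -- `τ > 0`: an interior local maximum of the energy with negative derivative
    have hgτ : g τ = Estar ^ 2 / 2 := by simp only [hg, heq]
    have hmax : IsLocalMax g τ := by
      show ∀ᶠ s in nhds τ, g s ≤ g τ
      filter_upwards [Ici_mem_nhds hpos] with s hs
      rw [hgτ]
      exact hle' s s ⟨hs, le_rfl⟩
    have hzero := hmax.hasDerivAt_eq_zero ((he τ hτ).hasDerivAt (Ici_mem_nhds hpos))
    have hlt := hkey τ hτ heq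
    linarith
  · -- `τ = 0`: contradicts `‖v 0‖ < E*`
    subst hzero
    exact (lt_irrefl _) (heq ▸ h0)

end Summit.NavierStokesRegularity.NavierStokesRegularity.Theorems
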